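import Mathlib
import HarnessLib
import Summits.ABC.ABC.Theses.CongruentialReceptacle
import Summits.ABC.ABC.Theorems.CongruentialReceptacleCompactBalanceTransferSelfImprovement
import Summits.ABC.ABC.Theorems.CongruentialReceptacleCompactBalanceTransferFirstTooth
import Literature.NumberTheory.DiophantineGeometry.AbcWave0UniformABCProofs

/-!
# LADDER below the crux `CompactBalanceTransfer` (stmt-ABC-1725) — typed rung families, floors, on-path maps

Forward generator G4 `ladder-down` (seat `planner-fwd-ladder-ABC-50-0`, 2026-08-17), companion of
`Cruxes/CompactBalanceTransfer/LADDER.md`. The crux is `CompactBalanceTransfer := H → ABC` with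
`H := ∀ κ > 0, ∀ ε > 0, ∃ C, ∀ abc-triples, κc ≤ a → κc ≤ b → c < C·rad(abc)^(1+ε)` (abc on every compactly balanced
cell). A RUNG is a consequence `R` of the crux (`crux → R` proved here: "on-path"), graded by a parameter of the
crux's own language, whose extreme value is the crux; the FLOOR of a family is its highest PROVED rung.

Three gradations survive the collapse theorems already in the tree (`Negative/QuarterReduction`: the `κ`-axis of `H`
collapses to `κ = 1/4`; `Negative/DepthCellDissolution`: every depth-window restriction of the conclusion is `↔ ABC`):

* **θ₅ — polynomial `κ`-modulus `B` and conclusion exponent `θ`.** `PolyBalancedABC B` (balanced abc with constants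
  `A_ε·κ^(−B)`; `B = 1/3` is LITERALLY the tree's `P ↔ F` = Frey–Szpiro `6+ε`, `SelfImprovement.freySzpiroAll_iff_polyBalanced`;
  `B = 0` is `ABC`), `RungB B := PolyBalancedABC B → ABC` (so `RungB (1/3)` = child 2 `FreySzpiroToABC` of split D1),
  and the two-parameter sub-ladder `RungBTheta B θ := PolyBalancedABC B → AbcExp θ`.
  FLOOR (proved here, `rungBTheta_floor`): `RungBTheta B (1/(1−B))` for `B < 1` — at `B = 1/3` this is Oesterlé's
  `F ⟹ abc with exponent 3/2` (`PowerDeep.abc_threeHalves_of_freySzpiro`). LIMIT: `(∀ θ > 1, RungBTheta B θ) → RungB B`.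
  NEXT RUNG (typed, open): `NextRungFreySzpiro := ∃ θ < 3/2, RungBTheta (1/3) θ`.
* **θ₇ — degree `d` of the hypothesis (GenEll currency).** `UniformBalancedABC d` (crux-ideator 2's typing, copied verbatim:
  Granville–Stark uniform abc `abc.S21` restricted to points `κ`-balanced at every complex embedding, degree `≤ d`),
  `RungDeg d := UniformBalancedABC d → ABC`, monotone in `d`; `RungDeg 1 ← crux` via the `K = ℚ` normalisation
  `balancedABC_of_uniformBalancedABC_one` (PROVED here, adapting `UniformABCConjecture.abc_rat`).
  FLOOR (print): `KummerBalanceTransfer := (∀ d, UniformBalancedABC d) → ABC` [cite: MochizukiGenEll2010, Thm 2.1 (ii)⇒(i),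
  pp. 11–13: étale cover with ramification `e ≳ 3/ε` + noncritical Belyi map]; every rung implies it (`kummer_of_rungDeg`).
  NEXT RUNG (typed, open): `NextRungDeg := ∃ d, RungDeg d`.
* **θ₄ — the family of deep triples reached (teeth).** FLOOR: `FirstTooth.abc_pythagorean_of_balancedABC` (`H` ⟹ abc, same `ε`,
  on `((y−x)², 2xy, x²+y²)` for `κ′y ≤ x < y`). NEXT RUNG (typed, open; F1 shape "one hypothesis dropped"): `RungPyth` = the
  same on the WHOLE Pythagorean surface (`0 < x < y` coprime), where the balanced partner `(x², y², x²+y²)` is lost as `x/y → 0`.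

For each next rung: `crux → rung` and `ABC → rung` are proved below (on-path / converse); `rung → crux`, `rung → ABC` and
`floor → rung` FAIL the cheap batteries (seat folder `bc/probes.lean`, recorded in LADDER.md). None of the three composes to the
crux with a second honest stub (LADDER.md §5), so no line is registered; the rungs are banked here.
No `sorry`; standard axioms; no named facts (the GenEll floor is cited, never assumed).
-/

-- `Summit.<Summit>.<Problem>`: for the single-conjunct summit `ABC` the duplicate `ABC.ABC` is mandated.
set_option linter.dupNamespace false

namespace Summit.ABC.ABC.Cruxes.CompactBalanceTransfer.Ladder

open Literature.NumberTheory.DiophantineGeometry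
open Summit.ABC.ABC.Theses.CongruentialReceptacle
open Summit.ABC.ABC.Theorems.CompactBalanceTransfer

/-! ## The top: `crux = (H → ABC)` -/

/-- `H`: abc on every compactly balanced cell (the hypothesis of the crux). [folklore] -/
def BalancedABC : Prop :=
  ∀ κ : ℝ, 0 < κ → ∀ ε : ℝ, 0 < ε → ∃ C : ℝ, ∀ a b c : ℕ, IsABCTriple a b c →
    κ * (c : ℝ) ≤ (a : ℝ) → κ * (c : ℝ) ≤ (b : ℝ) → (c : ℝ) < C * ((rad a b c : ℕ) : ℝ) ^ (1 + ε)

/-- The crux is literally `H → ABC`. [folklore] -/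
theorem crux_iff : CompactBalanceTransfer ↔ (BalancedABC → _root_.ABC) := Iff.rfl

/-- Converse direction of the top (informational, F4): `ABC → crux`. [folklore] -/
theorem crux_of_abc (h : _root_.ABC) : CompactBalanceTransfer := fun _ => h

/-! ## θ₅ — polynomial `κ`-modulus `B`, conclusion exponent `θ` -/

/-- abc with exponent `θ` (all `ε`-losses allowed): `∀ ε > 0, ∃ C, c < C·rad^(θ+ε)`. `AbcExp 1` is `ABC` up to the
sign condition on `C`. [folklore] -/
def AbcExp (θ : ℝ) : Prop :=
  ∀ ε : ℝ, 0 < ε → ∃ C : ℝ, ∀ a b c : ℕ, IsABCTriple a b c →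
    (c : ℝ) < C * ((rad a b c : ℕ) : ℝ) ^ (θ + ε)

/-- Balanced abc with POLYNOMIAL `κ`-modulus of exponent `B`: constants `A_ε·κ^(−B)` uniform down to `κ → 0`.
`B = 1/3` is the tree's `P` (`↔` Frey–Szpiro `F`); `B = 0` gives `ABC` (`rungB_zero`). [folklore] -/
def PolyBalancedABC (B : ℝ) : Prop :=
  ∀ ε : ℝ, 0 < ε → ∃ A : ℝ, ∀ κ : ℝ, 0 < κ → ∀ a b c : ℕ, IsABCTriple a b c →
    κ * (c : ℝ) ≤ (a : ℝ) → κ * (c : ℝ) ≤ (b : ℝ) →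
      (c : ℝ) < A * κ ^ (-B) * ((rad a b c : ℕ) : ℝ) ^ (1 + ε)

/-- Rung family θ₅: `PolyBalancedABC B → ABC`. [folklore] -/
def RungB (B : ℝ) : Prop := PolyBalancedABC B → _root_.ABC

/-- Two-parameter sub-ladder: `PolyBalancedABC B → abc with exponent θ`. [folklore] -/
def RungBTheta (B θ : ℝ) : Prop := PolyBalancedABC B → AbcExp θ

/-- `PolyBalancedABC B → H` (fix `κ`). [folklore] -/
theorem balancedABC_of_polyBalanced (B : ℝ) (hP : PolyBalancedABC B) : BalancedABC := by
  intro κ hκ ε hε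
  obtain ⟨A, hA⟩ := hP ε hε
  exact ⟨A * κ ^ (-B), fun a b c h ha hb => hA κ hκ a b c h ha hb⟩

/-- ON-PATH: the crux gives every rung `RungB B`. [folklore] -/
theorem rungB_of_crux (hT : CompactBalanceTransfer) (B : ℝ) : RungB B :=
  fun hP => hT (balancedABC_of_polyBalanced B hP)

/-- The radical is positive (re-export of the tree lemma). [folklore] -/
theorem rad_pos_real (a b c : ℕ) : (0 : ℝ) < ((rad a b c : ℕ) : ℝ) := by
  exact_mod_cast PowerDeep.rad_pos_nat a b c

/-- FLOOR of θ₅ in `B`: `RungB 0` holds (at `κ := 1/c` every triple is balanced and `κ^(−0) = 1`). [folklore] -/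
theorem rungB_zero : RungB 0 := by
  intro hP
  rw [_root_.ABC_iff]
  intro ε hε
  obtain ⟨A, hA⟩ := hP ε hε
  refine ⟨max A 1, lt_max_of_lt_right one_pos, fun a b c habc => ?_⟩
  have ha : 0 < a := habc.1
  have hb : 0 < b := habc.2.1
  have hc : (0 : ℝ) < c := by have := habc.2.2.1; exact_mod_cast (show 0 < c by omega)
  have h0 := hA (c : ℝ)⁻¹ (inv_pos.mpr hc) a b c habc
    (by rw [inv_mul_cancel₀ hc.ne']; exact_mod_cast ha)
    (by rw [inv_mul_cancel₀ hc.ne']; exact_mod_cast hb)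
  simp only [neg_zero, Real.rpow_zero, mul_one] at h0
  exact lt_of_lt_of_le h0 (mul_le_mul_of_nonneg_right (le_max_left _ _) (by positivity))

/-- `RungB (1/3)` IS child 2 of the currency split D1 (`F → ABC`, Oesterlé 1988), by the tree's `F ↔ P`
(`SelfImprovement.freySzpiroAll_iff_polyBalanced`, p139684). [folklore] -/
theorem rungB_third_iff_child2 :
    RungB (1 / 3) ↔
      ((∀ ε : ℝ, 0 < ε → ∃ C : ℝ, ∀ a b c : ℕ, IsABCTriple a b c →
          ((a * b * c : ℕ) : ℝ) ^ 2 ≤ C * ((rad a b c : ℕ) : ℝ) ^ (6 + ε)) → _root_.ABC) := by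
  unfold RungB PolyBalancedABC
  exact ⟨fun h hF => h (SelfImprovement.freySzpiroAll_iff_polyBalanced.mp hF),
    fun h hP => h (SelfImprovement.freySzpiroAll_iff_polyBalanced.mpr hP)⟩

/-- CONVERSE (informational, F4): `ABC → RungBTheta B θ` for `θ ≥ 1`. [folklore] -/
theorem rungBTheta_of_abc (h : _root_.ABC) (B θ : ℝ) (hθ : 1 ≤ θ) : RungBTheta B θ := by
  intro _ ε hε
  obtain ⟨C, hC0, hC⟩ := (_root_.ABC_iff.mp h) ε hε
  refine ⟨C, fun a b c habc => lt_of_lt_of_le (hC a b c habc) ?_⟩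
  have hR1 : (1 : ℝ) ≤ ((rad a b c : ℕ) : ℝ) := by exact_mod_cast PowerDeep.rad_pos_nat a b c
  exact mul_le_mul_of_nonneg_left (Real.rpow_le_rpow_of_exponent_le hR1 (by linarith)) hC0.le

/-- ON-PATH: the crux gives `RungBTheta B θ` for every `θ ≥ 1`. [folklore] -/
theorem rungBTheta_of_crux (hT : CompactBalanceTransfer) (B θ : ℝ) (hθ : 1 ≤ θ) : RungBTheta B θ :=
  fun hP => rungBTheta_of_abc (hT (balancedABC_of_polyBalanced B hP)) B θ hθ hP

/-- LIMIT of the `θ`-sub-ladder: all exponents `θ > 1` together are the rung `RungB B`. [folklore] -/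
theorem rungB_of_forall_theta {B : ℝ} (h : ∀ θ : ℝ, 1 < θ → RungBTheta B θ) : RungB B := by
  intro hP
  rw [_root_.ABC_iff]
  intro ε hε
  obtain ⟨C, hC⟩ := h (1 + ε / 2) (by linarith) hP (ε / 2) (by positivity)
  refine ⟨max C 1, lt_max_of_lt_right one_pos, fun a b c habc => ?_⟩
  have h1 := hC a b c habc
  rw [show (1 + ε / 2 + ε / 2 : ℝ) = 1 + ε by ring] at h1
  exact lt_of_lt_of_le h1 (mul_le_mul_of_nonneg_right (le_max_left _ _) (by positivity))

/-- **FLOOR of the `θ`-sub-ladder (proved): `PolyBalancedABC B ⟹ abc with exponent 1/(1−B)`** for `B < 1`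
(content for `0 ≤ B`; for `B < 0` the hypothesis is stronger than abc itself).
At the triple's own scale `κ := 1/c` the hypothesis reads `c < A·c^B·rad^(1+ε')`, i.e. `c^(1−B) < A·rad^(1+ε')`.
`B = 1/3` recovers Oesterlé's `3/2` (`PowerDeep.abc_threeHalves_of_freySzpiro`); the bound is attained with zero slack
on `a = 1` (there `κ ≤ 1/c` is forced), which is where every attempt on the next rung stops (LADDER.md §3). [folklore] -/
theorem rungBTheta_floor {B : ℝ} (hB1 : B < 1) : RungBTheta B (1 / (1 - B)) := by
  intro hP ε hε
  have h1B : (0 : ℝ) < 1 - B := by linarith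
  have h1Bne : (1 - B : ℝ) ≠ 0 := h1B.ne'
  have hε' : (0 : ℝ) < ε * (1 - B) := mul_pos hε h1B
  obtain ⟨A, hA⟩ := hP (ε * (1 - B)) hε'
  set L : ℝ := Real.log (max A 1) with hL
  refine ⟨Real.exp (L / (1 - B)), fun a b c habc => ?_⟩
  have ha : 0 < a := habc.1
  have hb : 0 < b := habc.2.1
  have hc : (0 : ℝ) < c := by have := habc.2.2.1; exact_mod_cast (show 0 < c by omega)
  have hR : (0 : ℝ) < ((rad a b c : ℕ) : ℝ) := rad_pos_real a b c
  set R : ℝ := ((rad a b c : ℕ) : ℝ) with hRdef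
  have hmax : (0 : ℝ) < max A 1 := lt_max_of_lt_right one_pos
  -- the hypothesis at the triple's own scale κ = 1/c
  have h0 := hA (c : ℝ)⁻¹ (inv_pos.mpr hc) a b c habc
    (by rw [inv_mul_cancel₀ hc.ne']; exact_mod_cast ha)
    (by rw [inv_mul_cancel₀ hc.ne']; exact_mod_cast hb)
  have e : ((c : ℝ)⁻¹) ^ (-B) = (c : ℝ) ^ B := by
    rw [Real.rpow_neg (inv_nonneg.mpr hc.le), Real.inv_rpow hc.le, inv_inv]
  have hcB : (0 : ℝ) < (c : ℝ) ^ B := Real.rpow_pos_of_pos hc B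
  have hR' : (0 : ℝ) < R ^ (1 + ε * (1 - B)) := Real.rpow_pos_of_pos hR _
  have h1 : (c : ℝ) < max A 1 * ((c : ℝ) ^ B * R ^ (1 + ε * (1 - B))) := by
    calc (c : ℝ) < A * ((c : ℝ)⁻¹) ^ (-B) * R ^ (1 + ε * (1 - B)) := h0
      _ = A * ((c : ℝ) ^ B * R ^ (1 + ε * (1 - B))) := by rw [e]; ring
      _ ≤ max A 1 * ((c : ℝ) ^ B * R ^ (1 + ε * (1 - B))) :=
          mul_le_mul_of_nonneg_right (le_max_left _ _) (by positivity)
  -- logarithms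
  have hlog : Real.log c < L + B * Real.log c + (1 + ε * (1 - B)) * Real.log R := by
    have h := Real.log_lt_log hc h1
    rw [Real.log_mul hmax.ne' (by positivity), Real.log_mul hcB.ne' hR'.ne', Real.log_rpow hc,
      Real.log_rpow hR] at h
    linarith
  have hkey : Real.log c < L / (1 - B) + (1 / (1 - B) + ε) * Real.log R := by
    have e1 : L / (1 - B) + (1 / (1 - B) + ε) * Real.log R =
        (L + (1 + ε * (1 - B)) * Real.log R) / (1 - B) := by
      field_simp
    rw [e1, lt_div_iff₀ h1B]
    linarith
  calc (c : ℝ) = Real.exp (Real.log c) := (Real.exp_log hc).symm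
    _ < Real.exp (L / (1 - B) + (1 / (1 - B) + ε) * Real.log R) := Real.exp_lt_exp.mpr hkey
    _ = Real.exp (L / (1 - B)) * R ^ (1 / (1 - B) + ε) := by
        rw [Real.exp_add, Real.rpow_def_of_pos hR, mul_comm (Real.log R)]

/-- The floor at Frey–Szpiro strength: `RungBTheta (1/3) (3/2)` (Oesterlé's exponent). [folklore] -/
theorem rungBTheta_third_threeHalves : RungBTheta (1 / 3) (3 / 2) := by
  have h := rungBTheta_floor (B := 1 / 3) (by norm_num)
  have e : (1 / (1 - 1 / 3) : ℝ) = 3 / 2 := by norm_num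
  rw [e] at h
  exact h

/-- **NEXT RUNG of θ₅ (typed, OPEN): beat Oesterlé's `3/2` from Frey–Szpiro strength.** Some exponent `θ < 3/2` with
`PolyBalancedABC (1/3) → AbcExp θ` (equivalently `F → abc_θ`). Implied by the crux and by `ABC`; not implied cheaply by the
floor `θ = 3/2`; does not give the crux or `ABC` cheaply (LADDER.md §3, probes). [folklore] -/
def NextRungFreySzpiro : Prop := ∃ θ : ℝ, θ < 3 / 2 ∧ RungBTheta (1 / 3) θ

/-- ON-PATH: `crux → NextRungFreySzpiro` (with `θ = 1`). [folklore] -/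
theorem nextRungFreySzpiro_of_crux (hT : CompactBalanceTransfer) : NextRungFreySzpiro :=
  ⟨1, by norm_num, rungBTheta_of_crux hT _ _ le_rfl⟩

/-- CONVERSE (informational): `ABC → NextRungFreySzpiro`. [folklore] -/
theorem nextRungFreySzpiro_of_abc (h : _root_.ABC) : NextRungFreySzpiro :=
  ⟨1, by norm_num, rungBTheta_of_abc h _ _ le_rfl⟩

/-! ## θ₇ — degree of the hypothesis (GenEll currency) -/

/-- Balanced UNIFORM abc over number fields of degree `≤ d` (Granville–Stark / Masser shape `abc.S21`, exponent `1 + ε` on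
`|D_K|·N_K`, constant `C ^ [K:ℚ]`), for projective points `(a : b : c)`, `a + b = c`, that are `κ`-balanced at EVERY complex
embedding. Copied verbatim from crux-ideator 2 (`Cruxes/CompactBalanceTransfer/Sketch_ideator2_r1.lean`, also
`StrategySplit.lean`). For `d = 1` it is `H` (`balancedABC_of_uniformBalancedABC_one`). [folklore] -/
def UniformBalancedABC (d : ℕ) : Prop :=
  ∀ κ : ℝ, 0 < κ → ∀ ε : ℝ, 0 < ε → ∃ C : ℝ, ∀ (K : Type) [Field K] [NumberField K] (a b c : K),
    Module.finrank ℚ K ≤ d → a ≠ 0 → b ≠ 0 → c ≠ 0 → a + b = c →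
    (∀ σ : K →+* ℂ, κ * ‖σ c‖ ≤ ‖σ a‖ ∧ κ * ‖σ c‖ ≤ ‖σ b‖) →
      Height.mulHeight ![a, b, c] <
        C ^ Module.finrank ℚ K *
          ((|NumberField.discr K| : ℝ) * (radicalNorm a b c : ℝ)) ^ (1 + ε)

/-- Rung family θ₇: compactly-balanced uniform abc in degree `≤ d` implies abc. `d = 1` is the crux (up to the `K = ℚ`
normalisation); `d = ∞` (all degrees) is GenEll Thm 2.1. [folklore] -/
def RungDeg (d : ℕ) : Prop := UniformBalancedABC d → _root_.ABC

/-- The hypothesis is antitone in the degree bound. [folklore] -/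
theorem uniformBalancedABC_anti {d d' : ℕ} (hdd : d ≤ d') (h : UniformBalancedABC d') :
    UniformBalancedABC d := by
  intro κ hκ ε hε
  obtain ⟨C, hC⟩ := h κ hκ ε hε
  exact ⟨C, fun K _ _ a b c hK => hC K a b c (le_trans hK hdd)⟩

/-- The rungs are monotone in `d`: a larger degree bound is a stronger hypothesis, hence a weaker rung. [folklore] -/
theorem rungDeg_mono {d d' : ℕ} (hdd : d ≤ d') (h : RungDeg d) : RungDeg d' :=
  fun hU => h (uniformBalancedABC_anti hdd hU)

/-- **`K = ℚ` normalisation (proved): `UniformBalancedABC 1 → H`.** For an abc triple viewed in `ℚ`: `[ℚ:ℚ] = 1`,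
`D_ℚ = 1`, `H_ℚ(a:b:c) = c` (`UniformABCConjecture.mulHeight_natCast_eq`), `N_ℚ ≤ rad`
(`UniformABCConjecture.radicalNorm_natCast_le_rad`), and `κc ≤ a, b` transports to the unique complex embedding.
(Adapted from `UniformABCConjecture.abc_rat`.) [folklore] -/
theorem balancedABC_of_uniformBalancedABC_one (h : UniformBalancedABC 1) : BalancedABC := by
  intro κ hκ ε hε
  obtain ⟨C, hC⟩ := h κ hκ ε hε
  refine ⟨max C 1, fun a b c ht hκa hκb => ?_⟩
  have ha : 0 < a := ht.1
  have hb : 0 < b := ht.2.1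
  have hc : 0 < c := by have := ht.2.2.1; omega
  have habc : a * b * c ≠ 0 := by positivity
  have hbal : ∀ σ : ℚ →+* ℂ, κ * ‖σ (c : ℚ)‖ ≤ ‖σ (a : ℚ)‖ ∧ κ * ‖σ (c : ℚ)‖ ≤ ‖σ (b : ℚ)‖ := by
    intro σ
    simp only [map_natCast, Complex.norm_natCast]
    exact ⟨hκa, hκb⟩
  have H := hC ℚ (a : ℚ) (b : ℚ) (c : ℚ) (by simp) (by exact_mod_cast ha.ne')
    (by exact_mod_cast hb.ne') (by exact_mod_cast hc.ne') (by exact_mod_cast ht.2.2.1) hbal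
  have H' : (c : ℝ) < C ^ Module.finrank ℚ ℚ *
      ((|NumberField.discr ℚ| : ℝ) * (radicalNorm (a : ℚ) (b : ℚ) (c : ℚ) : ℝ)) ^ (1 + ε) :=
    lt_of_eq_of_lt (UniformABCConjecture.mulHeight_natCast_eq ht).symm H
  simp only [Module.finrank_self, pow_one, Rat.numberField_discr, Int.cast_one, abs_one,
    one_mul] at H'
  have hN : (radicalNorm (a : ℚ) (b : ℚ) (c : ℚ) : ℝ) ≤ ((rad a b c : ℕ) : ℝ) := by
    exact_mod_cast UniformABCConjecture.radicalNorm_natCast_le_rad habc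
  have hpow : (radicalNorm (a : ℚ) (b : ℚ) (c : ℚ) : ℝ) ^ (1 + ε) ≤
      ((rad a b c : ℕ) : ℝ) ^ (1 + ε) :=
    Real.rpow_le_rpow (Nat.cast_nonneg _) hN (by linarith)
  calc (c : ℝ) < C * (radicalNorm (a : ℚ) (b : ℚ) (c : ℚ) : ℝ) ^ (1 + ε) := H'
    _ ≤ max C 1 * (radicalNorm (a : ℚ) (b : ℚ) (c : ℚ) : ℝ) ^ (1 + ε) :=
      mul_le_mul_of_nonneg_right (le_max_left C 1) (by positivity)
    _ ≤ max C 1 * ((rad a b c : ℕ) : ℝ) ^ (1 + ε) :=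
      mul_le_mul_of_nonneg_left hpow (by positivity)

/-- ON-PATH: the crux gives every rung `RungDeg d`, `d ≥ 1`. [folklore] -/
theorem rungDeg_of_crux (hT : CompactBalanceTransfer) {d : ℕ} (hd : 1 ≤ d) : RungDeg d :=
  fun hU => hT (balancedABC_of_uniformBalancedABC_one (uniformBalancedABC_anti hd hU))

/-- CONVERSE (informational): `ABC → RungDeg d`. [folklore] -/
theorem rungDeg_of_abc (h : _root_.ABC) (d : ℕ) : RungDeg d := fun _ => h

/-- FLOOR of θ₇ (in print, cited — never assumed): compactly-balanced uniform abc in EVERY bounded degree implies abc,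
the over-`ℚ` conclusion of [cite: MochizukiGenEll2010, Thm 2.1] (proof pp. 11–13: étale Galois cover `Y → P¹` with all
ramification indices `e`, `(1 − 3/e)⁻¹ ≤ 1 + ε′`, then a noncritical Belyi map `Y → P¹` at the `v`-adic limit points of a
violating sequence). Same `Prop` as crux-ideator 2's `KummerBalanceTransfer`. [folklore] -/
def KummerBalanceTransfer : Prop := (∀ d : ℕ, UniformBalancedABC d) → _root_.ABC

/-- Every finite-degree rung implies the floor. [folklore] -/
theorem kummer_of_rungDeg (d : ℕ) (h : RungDeg d) : KummerBalanceTransfer := fun hall => h (hall d)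

/-- **NEXT RUNG of θ₇ (typed, OPEN): SOME finite degree suffices.** [folklore] -/
def NextRungDeg : Prop := ∃ d : ℕ, RungDeg d

/-- ON-PATH: `crux → NextRungDeg` (`d = 1`). [folklore] -/
theorem nextRungDeg_of_crux (hT : CompactBalanceTransfer) : NextRungDeg := ⟨1, rungDeg_of_crux hT le_rfl⟩

/-- CONVERSE (informational): `ABC → NextRungDeg`. [folklore] -/
theorem nextRungDeg_of_abc (h : _root_.ABC) : NextRungDeg := ⟨1, rungDeg_of_abc h 1⟩

/-- The next rung implies the floor. [folklore] -/
theorem kummer_of_nextRungDeg (h : NextRungDeg) : KummerBalanceTransfer := by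
  obtain ⟨d, hd⟩ := h
  exact kummer_of_rungDeg d hd

/-! ## θ₄ — teeth: the Pythagorean surface -/

/-- **NEXT RUNG of θ₄ (typed, OPEN): `H` ⟹ abc (same `ε`) on the WHOLE Pythagorean surface** `((y−x)², 2xy, x²+y²)`,
`0 < x < y` coprime — the floor `FirstTooth.abc_pythagorean_of_balancedABC` with its one balance hypothesis `κ′y ≤ x`
dropped. On `x/y → 0` the partner `(x², y², x²+y²)` leaves every balanced cell (the `x = 1` edge is the `a = 1`-type
family `(1, y², y²+1)`), so the floor's proof stops exactly there. [folklore] -/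
def RungPyth : Prop :=
  BalancedABC → ∀ ε : ℝ, 0 < ε → ∃ C : ℝ, ∀ x y : ℕ, 0 < x → x < y → Nat.Coprime x y →
    ((x ^ 2 + y ^ 2 : ℕ) : ℝ) < C * ((rad ((y - x) ^ 2) (2 * x * y) (x ^ 2 + y ^ 2) : ℕ) : ℝ) ^ (1 + ε)

/-- FLOOR of θ₄ (F3 special): the balanced slice of `RungPyth` is the landed tooth. [folklore] -/
theorem rungPyth_floor :
    BalancedABC → ∀ κ' : ℝ, 0 < κ' → ∀ ε : ℝ, 0 < ε → ∃ C : ℝ, ∀ x y : ℕ, 0 < x → x < y → Nat.Coprime x y →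
      κ' * (y : ℝ) ≤ (x : ℝ) →
        ((x ^ 2 + y ^ 2 : ℕ) : ℝ) < C * ((rad ((y - x) ^ 2) (2 * x * y) (x ^ 2 + y ^ 2) : ℕ) : ℝ) ^ (1 + ε) :=
  FirstTooth.abc_pythagorean_of_balancedABC

/-- The rung specialises to its floor (drop the balance hypothesis). [folklore] -/
theorem floor_of_rungPyth (h : RungPyth) :
    BalancedABC → ∀ κ' : ℝ, 0 < κ' → ∀ ε : ℝ, 0 < ε → ∃ C : ℝ, ∀ x y : ℕ, 0 < x → x < y → Nat.Coprime x y →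
      κ' * (y : ℝ) ≤ (x : ℝ) →
        ((x ^ 2 + y ^ 2 : ℕ) : ℝ) < C * ((rad ((y - x) ^ 2) (2 * x * y) (x ^ 2 + y ^ 2) : ℕ) : ℝ) ^ (1 + ε) := by
  intro hH κ' _ ε hε
  obtain ⟨C, hC⟩ := h hH ε hε
  exact ⟨C, fun x y hx hxy hcop _ => hC x y hx hxy hcop⟩

/-- CONVERSE (informational): `ABC → RungPyth` (abc for the coprime partner `(x², y², x²+y²)`, whose radical the
Pythagorean triple's dominates: `FirstTooth.rad_partner_le_rad_pythagorean`). [folklore] -/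
theorem rungPyth_of_abc (h : _root_.ABC) : RungPyth := by
  intro _ ε hε
  obtain ⟨C, hC0, hC⟩ := (_root_.ABC_iff.mp h) ε hε
  refine ⟨C, fun x y hx hxy hcop => ?_⟩
  have hy : 0 < y := lt_trans hx hxy
  have hT := FirstTooth.partner_pythagorean_isABCTriple hx hy hcop
  have hrad := FirstTooth.rad_partner_le_rad_pythagorean hx hxy
  have h1 := hC (x ^ 2) (y ^ 2) (x ^ 2 + y ^ 2) hT
  refine lt_of_lt_of_le h1 (mul_le_mul_of_nonneg_left ?_ hC0.le)
  exact Real.rpow_le_rpow (Nat.cast_nonneg _) (by exact_mod_cast hrad) (by linarith)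

/-- ON-PATH: `crux → RungPyth`. [folklore] -/
theorem rungPyth_of_crux (hT : CompactBalanceTransfer) : RungPyth := fun hH => rungPyth_of_abc (hT hH) hH

end Summit.ABC.ABC.Cruxes.CompactBalanceTransfer.Ladder
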